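import Summits.QuantumFields.YangMills.Theorems.BalabanUVNodesK0AxJoinT

/-!
# LANDING NOTE (porter PTC-1 g3, 2026-08-31; AUTHORSHIP = ◇ lens-1 g9, HOME sketch `nodeO-cover/LENS-1g9-JoinT-v1.1.lean` sha16 12ba32c4290d3909; ★★★ director-ym №527 (b); ◆ CRIT-1 g36 CUT).
# THIS FILE `…K0AxJoinTRecord.lean` = the sketch's §E — sorry-free bookkeeping AT THE RECORD: `twoRate_le`, `eventually_atTop_of_add`,
# `recordPvolTwoVolExpOnRunsAx_of_eventually ∕ _of_le_radius ∕ _of_members` (member-indexed two-rate bound with a DISPLAYED seam separation `Rsep k n ≥ cR·recordN` ⟹ [E]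
# `K0AxTwoVolumeRate.RecordPvolTwoVolExpOnRunsAx` at rate `δ₁·cR`) and ★★★ `joinConclLimR_of_decayConclR_twoVolExp` (the radius-uniform decay JOIN's consequent carrying [E] under
# the SAME `∃ γ₀ ε₂₉` ⟹ `PortHRecordJoin.JoinConclLimR Tok F`).  Companions: ✓`…K0AxJoinTLeaves.lean` (§A + §B; full author docstring) and ✓`…K0AxJoinT.lean` (§C + §D).  §K
# (`kstep_joinT_at_record`, the ONE declared `sorry`, STRUCK AS TYPED by ◆'s cut and re-pinned by the author) is NOT landed.  CONDITIONAL ∕ bookkeeping only; nothing of Bałaban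
# asserted, ported, discharged or refuted; [E] inhabited nowhere; K0ᴬ stmt-QuantumFields-27238 OPEN; NODE O 0∕1; COUNT 8∕28 · K 1∕4 UNMOVED; finite 𝕋⁴ at fixed ε — NOT continuum ∕
# OS ∕ Clay; the Yang–Mills mass gap is NOT proved by any of this.
-/

noncomputable section

open Filter Topology
open scoped BigOperators

namespace Summit.QuantumFields.YangMills.Theorems.K0AxJoinT

open Literature.MathematicalPhysics.QuantumFieldTheory.Balaban1983to89
open Literature.MathematicalPhysics.QuantumFieldTheory.Balaban1983to89.Node00 (TermFamily1 siteOfInt polWindow polScalar betaOfRecord₁₃Ax)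
open Literature.MathematicalPhysics.QuantumFieldTheory.Balaban1983to89.T4Continuum (T4Family)
open Literature.MathematicalPhysics.QuantumFieldTheory.Balaban1983to89.B12FormatPlus
open Literature.MathematicalPhysics.QuantumFieldTheory.Balaban1983to89.B12Decay510 (SiteGeometry GeomLeaf CubeSumLeaf TreeLeaf KernelBound delta1 mixedDeriv
  sum_abs_le delta1_le_half delta1_mul_le delta1_nonneg)
open Literature.MathematicalPhysics.QuantumFieldTheory.Balaban1983to89.B12Decay510Gauge (norm_mixedDeriv_le_gauge kernelBound_of_gauge)
open Literature.MathematicalPhysics.QuantumFieldTheory.Balaban1983to89.B12Decay510TwoVolume (kernelBound_twoVolume_of_gauge mixedDeriv_nextMember_eq maskKernel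
  sum_filter_abs_eq_sum_abs_maskKernel comapLabels abs_sum_next_sub_sum_le_three)
open Literature.MathematicalPhysics.QuantumFieldTheory.Balaban1983to89.B12Eq435SecondVariation (ofReal_fderiv_fderiv_eq_sum_mixedDeriv_of_repr)
open Literature.MathematicalPhysics.QuantumFieldTheory.Balaban1983to89.Beta.RemainderLocality (mixedDeriv_comp_clm mixedDeriv_eq_fderiv_fderiv
  differentiableAt_fderiv_of_analyticAt)
open Summit.QuantumFields.YangMills.Theorems.K0RecordFormatNames (ΦfOf pvolOf plimOf)
open Summit.QuantumFields.YangMills.Theorems.PortH (exists_cutTo_clm pvolOf_eq_trace)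

/-! ## §E  AT THE RECORD — sorry-free bookkeeping: two rates into one, «eventually along members» ⟹ [E], and the IN-SCOPE JOIN composition -/

section Record

open Summit.QuantumFields.YangMills.Theorems.K0RecordFormatNames
open Summit.QuantumFields.YangMills.Theorems.K0AxTwoVolumeRate (RecordPvolTwoVolExpOnRunsAx recordPolLimitOnRunsAx_of_twoVolExp)
open Summit.QuantumFields.YangMills.Theorems.PortHRecordJoin (JoinAntecedents JoinConclLimR joinConclLimR_of_decayConclR inInterval_of_le_radius)
open Literature.MathematicalPhysics.QuantumFieldTheory.Balaban1983to89.FlowStep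
open Literature.MathematicalPhysics.QuantumFieldTheory.Balaban1983to89.FlowStepRuns

/-- Two exponential rates into one (the window rate `δ₀N∕2` and the seam rate `δ₁R` both dominate `κ′·s`). [cite: Balaban1987RG1, (1.21) p.264 (bookkeeping)] -/
theorem twoRate_le {A B δ₀ δ₁ N R κ' s : ℝ} (hA : 0 ≤ A) (hB : 0 ≤ B) (h₁ : κ' * s ≤ δ₀ * N / 2) (h₂ : κ' * s ≤ δ₁ * R) :
    A * Real.exp (-δ₀ * N / 2) + B * Real.exp (-δ₁ * R) ≤ (A + B) * Real.exp (-(κ' * s)) := by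
  have e₁ : Real.exp (-δ₀ * N / 2) ≤ Real.exp (-(κ' * s)) := Real.exp_le_exp.2 (by linarith)
  have e₂ : Real.exp (-δ₁ * R) ≤ Real.exp (-(κ' * s)) := Real.exp_le_exp.2 (by linarith)
  nlinarith [mul_le_mul_of_nonneg_left e₁ hA, mul_le_mul_of_nonneg_left e₂ hB]

/-- «Eventually along the members `K₀ + m`» is «eventually in the volume `K`». [cite: Balaban1987RG1, (1.21) p.264 (bookkeeping)] -/
theorem eventually_atTop_of_add {P : ℕ → Prop} (K₀ : ℕ) (h : ∀ᶠ m in atTop, P (K₀ + m)) : ∀ᶠ K in atTop, P K := by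
  obtain ⟨m₀, hm₀⟩ := eventually_atTop.1 h
  refine eventually_atTop.2 ⟨K₀ + m₀, fun K hK => ?_⟩
  obtain ⟨j, rfl⟩ := Nat.exists_eq_add_of_le hK
  have := hm₀ (m₀ + j) (Nat.le_add_right _ _)
  rwa [← add_assoc] at this

/-- **RECEIPT «eventually-in-K two-volume bound along runs ⟹ [E]»** (`∀ z, eventually in K` — never `eventually in K, ∀ z`). [cite: Balaban1987RG1, (1.21) p.264, (1.7) p.261] -/
theorem recordPvolTwoVolExpOnRunsAx_of_eventually (F : T4Family) (a₀ ε₂₉ γ : ℝ) {E₀' κ' : ℝ} (hκ' : 0 < κ')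
    (h : ∀ (n : ℕ) (gs : ℕ → ℝ), RGEqH n (betaOfRecord₁₃Ax F 2 (thetaFill F a₀ ε₂₉)) gs → Step.InInterval γ n gs → ∀ k, k ≤ n →
      ∀ (μ ν : Fin 4) (z : Fin 4 → ℤ), ∀ᶠ K in atTop,
        |recordPvolAx F a₀ ε₂₉ k (prefixOf gs k) (K + 1) μ ν z - recordPvolAx F a₀ ε₂₉ k (prefixOf gs k) K μ ν z| ≤
          E₀' * Real.exp (-(κ' * (((F.P K).sitesPerDir (k + 1) : ℕ) : ℝ)))) :
    RecordPvolTwoVolExpOnRunsAx F a₀ ε₂₉ γ E₀' κ' :=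
  ⟨hκ', fun n gs hrg hI k hk μ ν z => eventually_atTop.1 (h n gs hrg hI k hk μ ν z)⟩

/-- [E] is monotone in the radius: a bound along every `]0, γ₀]`-run is a bound along every `]0, γ]`-run for `γ ≤ γ₀`. [cite: Balaban1987RG1, Thm 1 p.259, (1.21) p.264 (bookkeeping)] -/
theorem recordPvolTwoVolExpOnRunsAx_of_le_radius (F : T4Family) (a₀ ε₂₉ : ℝ) {γ γ₀ E₀' κ' : ℝ} (hle : γ ≤ γ₀)
    (h : RecordPvolTwoVolExpOnRunsAx F a₀ ε₂₉ γ₀ E₀' κ') : RecordPvolTwoVolExpOnRunsAx F a₀ ε₂₉ γ E₀' κ' :=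
  ⟨h.1, fun n gs hrg hI => h.2 n gs hrg (inInterval_of_le_radius hI hle)⟩

/-- ★★★ **THE IN-SCOPE OUTPUT OF JOIN-T, COMPOSED BY NAME**: the radius-uniform decay JOIN's consequent (✓`PortHRecordJoin.decayConclR_of_texts`' shape) carrying, under the SAME
`∃ γ₀ ε₂₉`, the two-volume letter [E] at the level `γ₀` ⟹ `JoinConclLimR Tok F` (the (1.21) proviso DISCHARGED IN SCOPE: ✓`recordPolLimitOnRunsAx_of_twoVolExp` at every `γ ≤ γ₀`,
then ✓`joinConclLimR_of_decayConclR`).  From `JoinConclLimR` the doors are the tree's (✓`decayLetter_of_lim`, ✓`K0AxJoinResidual.record13SepCoPHInhabitedAx_of_lim_residual`).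
CONDITIONAL bookkeeping; nothing of Bałaban asserted. [cite: Balaban1987RG1, Thm 1 p.259, (1.21)–(1.22) p.264, (5.10) p.293, (0.20) p.256] -/
theorem joinConclLimR_of_decayConclR_twoVolExp {Tok : T4Family → ℕ → ℝ → Prop} {F : T4Family}
    (hD : ∃ Mth : ℕ, ∀ Mc : ℕ, Mth ≤ Mc → ∀ (j c c₀ c₁ : ℕ) (B₃ B₃' a₀ a₁ : ℝ), JoinAntecedents Tok F Mc j c c₀ c₁ B₃ B₃' a₀ a₁ →
      ∃ γ₀ ε₂₉ C δ₁ : ℝ, 0 < γ₀ ∧ 0 < ε₂₉ ∧ (∃ E₀' κ' : ℝ, RecordPvolTwoVolExpOnRunsAx F a₀ ε₂₉ γ₀ E₀' κ') ∧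
        ∀ γ : ℝ, γ ≤ γ₀ → (RecordPolLimitOnRunsAx F a₀ ε₂₉ γ → RecordPlimDecayOnRunsAx F a₀ ε₂₉ γ C δ₁)) :
    JoinConclLimR Tok F := by
  refine joinConclLimR_of_decayConclR ?_
  obtain ⟨Mth, h⟩ := hD
  refine ⟨Mth, fun Mc hMc j c c₀ c₁ B₃ B₃' a₀ a₁ hA => ?_⟩
  obtain ⟨γ₀, ε₂₉, C, δ₁, hγ₀, hε, ⟨E₀', κ', hE⟩, himp⟩ := h Mc hMc j c c₀ c₁ B₃ B₃' a₀ a₁ hA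
  exact ⟨γ₀, ε₂₉, C, δ₁, hγ₀, hε,
    fun γ hγ => recordPolLimitOnRunsAx_of_twoVolExp F a₀ ε₂₉ (recordPvolTwoVolExpOnRunsAx_of_le_radius F a₀ ε₂₉ hγ hE), himp⟩

/-- ★ **FROM THE MEMBER-INDEXED TWO-RATE BOUND TO [E]** (the shape ★★★ `twoVol_pvolOf_of_rows_trace` outputs at the record, member `n` = volume `recordK₀ F Mc k + n`, window
`N n := recordRNat`, a DISPLAYED seam separation `Rsep k n`): with the rate rows `cR·recordN ≤ Rsep` (some `0 < cR ≤ 1∕4`) and `recordN∕4 ≤ recordRNat` (✓`recordN_div_four_le_recordR`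
under `McGuard`, `recordK₀ ≤ K`, `2 ≤ domCount`, then `recordR ≤ recordRNat`) the two rates merge into `κ′ := δ₁·cR` against `recordN F k K = (F.P K).sitesPerDir (k+1)` and the
member-eventual bound is [E].  (The separation is NOT pinned to `recordR`: inner-window labels sit at distance `≈ recordR − Nin∕2` from the seam, so the honest `Rsep` is a fraction.) [cite: Balaban1987RG1, (1.21) p.264, (1.7) p.261, (0.20) p.256] -/
theorem recordPvolTwoVolExpOnRunsAx_of_members (F : T4Family) (a₀ ε₂₉ γ : ℝ) (Mc : ℕ) (Rsep : ℕ → ℕ → ℝ) {A B δ₀ δ₁ cR : ℝ} (hA : 0 ≤ A) (hB : 0 ≤ B)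
    (hδ₁ : 0 < δ₁) (hδ₁δ₀ : δ₁ ≤ δ₀ / 2) (hcR : 0 < cR) (hcR4 : cR ≤ 1 / 4)
    (hNR : ∀ k n, cR * (recordN F k (recordK₀ F Mc k + n) : ℝ) ≤ Rsep k n ∧
      (recordN F k (recordK₀ F Mc k + n) : ℝ) / 4 ≤ (recordRNat F Mc k (recordK₀ F Mc k + n) : ℝ))
    (h : ∀ (n : ℕ) (gs : ℕ → ℝ), RGEqH n (betaOfRecord₁₃Ax F 2 (thetaFill F a₀ ε₂₉)) gs → Step.InInterval γ n gs → ∀ k, k ≤ n →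
      ∀ (μ ν : Fin 4) (z : Fin 4 → ℤ), ∀ᶠ m in atTop,
        |recordPvolAx F a₀ ε₂₉ k (prefixOf gs k) (recordK₀ F Mc k + (m + 1)) μ ν z - recordPvolAx F a₀ ε₂₉ k (prefixOf gs k) (recordK₀ F Mc k + m) μ ν z| ≤
          A * Real.exp (-δ₀ * (recordRNat F Mc k (recordK₀ F Mc k + m) : ℝ) / 2) + B * Real.exp (-δ₁ * Rsep k m)) :
    RecordPvolTwoVolExpOnRunsAx F a₀ ε₂₉ γ (A + B) (δ₁ * cR) := by
  refine recordPvolTwoVolExpOnRunsAx_of_eventually F a₀ ε₂₉ γ (by positivity) fun n gs hrg hI k hk μ ν z => ?_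
  refine eventually_atTop_of_add (recordK₀ F Mc k) ?_
  filter_upwards [h n gs hrg hI k hk μ ν z] with m hm
  have hs : (((F.P (recordK₀ F Mc k + m)).sitesPerDir (k + 1) : ℕ) : ℝ) = (recordN F k (recordK₀ F Mc k + m) : ℝ) := rfl
  obtain ⟨hR, h4⟩ := hNR k m
  have hN0 : (0 : ℝ) ≤ recordN F k (recordK₀ F Mc k + m) := Nat.cast_nonneg _
  rw [← add_assoc] at hm
  refine hm.trans ?_
  rw [hs]
  refine twoRate_le hA hB ?_ ?_
  · have h₁ : δ₁ * cR ≤ δ₀ / 8 := by nlinarith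
    have h₂ : δ₁ * cR * (recordN F k (recordK₀ F Mc k + m) : ℝ) ≤ δ₀ / 8 * (recordN F k (recordK₀ F Mc k + m) : ℝ) := mul_le_mul_of_nonneg_right h₁ hN0
    nlinarith
  · have h₂ : δ₁ * (cR * (recordN F k (recordK₀ F Mc k + m) : ℝ)) ≤ δ₁ * Rsep k m := mul_le_mul_of_nonneg_left hR hδ₁.le
    nlinarith

end Record

end Summit.QuantumFields.YangMills.Theorems.K0AxJoinT

end
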